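import Literature.AlgebraicGeometry.Frobenioids.DivisorMonoidCategoryTheoreticityDefs
import Literature.AlgebraicGeometry.Frobenioids.PreFrobenioidDataOfFunctor
import Literature.AlgebraicGeometry.Frobenioids.PrimaryStepsComplete
import HarnessLib

/-!
# Frobenioids I, §4: Proposition 4.1 (i)–(v) AS TYPED — discharge of `PreFrobenioidData.Prop41i`,
# `Prop41ii`, `Prop41iii_criterion`, `Prop41iii_square`, `Prop41iv`, `Prop41v`

Mochizuki, *The geometry of Frobenioids I: the general theory*, Kyushu J. Math. **62** (2008)
293–400, §4, Proposition 4.1, kurims text pp. 75–77 [cite: MochizukiFrdI2008, Prop. 4.1 p.75].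

PROOF-ONLY companion of `DivisorMonoidCategoryTheoreticityDefs.lean` (statements, seat abc-iut-L1-t3):
for the operations `PreFrobenioidData.ofFunctor Φ F` of a Frobenioid `F : C ⥤ F_Φ`
(`hF : PreFrobenioid.IsFrobenioid F`), the five sub-items of Prop. 4.1 hold as typed, under the
standing hypothesis of §4 / Prop. 4.1 that `Φ` is perf-factorial (p. 75; needed for (ii)–(v), added
here as the hypothesis `hpf`, exactly as the statement file says: "the hypothesis '`Φ` perf-factorial',
Def. 2.4 (i), is a §2 notion and is added by the wrapper"). The support predicate of
`Prop41iii_criterion` is instantiated by disjointness of the supports `Supp` of Def. 2.4 (i)(d) of the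
images in `Φ(F)^pf` (`supp ∘ factorMap ∘ Perfection.of`, file `PerfFactorial.lean`). The proofs are
`PreFrobenioid.isPrimaryPreStep_iff_of_isStep`, `isPrimaryPreStep_comp_iff_of_isStep`,
`disjoint_supp_iff_isCoprimary`, `exists_coprimary_square_of_isCoprimary`,
`isPrimaryPreStep_iff_exists_prime_over/under` (files `PrimarySteps*.lean`, `CoprimarySteps.lean`,
`PerfFactorial{Primes,Splitting,Supports}.lean`) read through the adapter's `Iff` lemmas; the adapter
lemmas for the Def. 1.2 (iv)/(v) notions used by Prop. 4.1 that `PreFrobenioidDataOfFunctor.lean`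
does not yet carry are supplied first. No new definitions; no statement of the paper is changed.
-/

namespace Literature.AlgebraicGeometry.Frobenioids

open CategoryTheory Opposite

universe w v v' u u'

variable {D : Type u} [Category.{v} D] {Φ : Dᵒᵖ ⥤ CommMonCat.{w}} {C : Type u'} [Category.{v'} C]
  (F : C ⥤ ElemFrobenioid Φ)

namespace PreFrobenioidData

/-! ### Further Def. 1.2 notions through the adapter -/

/-- Step. [cite: MochizukiFrdI2008, Def. 1.2 (iii) p.22] -/
theorem ofFunctor_isStep {A B : C} (φ : A ⟶ B) :
    (ofFunctor Φ F).IsStep φ ↔ PreFrobenioid.IsStep F φ := Iff.rfl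

/-- Primary pre-step. [cite: MochizukiFrdI2008, Def. 1.2 (iii) p.22] -/
theorem ofFunctor_isPrimaryPreStep {A B : C} (φ : A ⟶ B) :
    (ofFunctor Φ F).IsPrimaryPreStep φ ↔ PreFrobenioid.IsPrimaryPreStep F φ := Iff.rfl

/-- Base-isomorphic objects. [cite: MochizukiFrdI2008, Def. 1.2 (ii) p.21] -/
theorem ofFunctor_baseIsomorphic (A B : C) :
    (ofFunctor Φ F).BaseIsomorphic A B ↔ PreFrobenioid.BaseIsomorphic F A B := Iff.rfl

/-- Perfect object (the two renderings quantify the base-isomorphic objects as `B ≅_D A` resp.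
`A ≅_D B`; symmetric). [cite: MochizukiFrdI2008, Def. 1.2 (iv) p.23] -/
theorem ofFunctor_isPerfectObj (A : C) :
    (ofFunctor Φ F).IsPerfectObj A ↔ PreFrobenioid.IsPerfectObj F A := by
  have hc : ∀ X : C, (ofFunctor Φ F).BaseIsomorphic X A ↔ PreFrobenioid.BaseIsomorphic F A X :=
    fun X => ⟨fun ⟨e⟩ => ⟨e.symm⟩, fun ⟨e⟩ => ⟨e.symm⟩⟩
  simp only [PreFrobenioidData.IsPerfectObj, PreFrobenioid.IsPerfectObj, ofFunctor_isFrobeniusType,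
    hc]
  rfl

/-- Of perfect type. [cite: MochizukiFrdI2008, Def. 1.2 (v) p.23] -/
theorem ofFunctor_isOfPerfectType :
    (ofFunctor Φ F).IsOfPerfectType ↔ PreFrobenioid.IsOfPerfectType F := by
  rw [PreFrobenioidData.isOfPerfectType_iff]
  exact forall_congr' fun A => ofFunctor_isPerfectObj F A

/-- Of isotropic type. [cite: MochizukiFrdI2008, Def. 1.2 (v) p.23] -/
theorem ofFunctor_isOfIsotropicType :
    (ofFunctor Φ F).IsOfIsotropicType ↔ PreFrobenioid.IsOfIsotropicType F := by
  rw [PreFrobenioidData.isOfIsotropicType_iff]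
  exact forall_congr' fun A => ofFunctor_isIsotropic F A

variable {F}

/-! ### Proposition 4.1 as typed -/

/-- **Proposition 4.1 (i)** as typed (`Prop41i`), for a Frobenioid. [cite: MochizukiFrdI2008, Prop. 4.1 (i) p.75] -/
theorem prop41i_holds (hF : PreFrobenioid.IsFrobenioid F) (A : C) (α : ℕ+ → End A) :
    (ofFunctor Φ F).Prop41i A α := by
  intro hS B φ hφ
  have hperf := (ofFunctor_isOfPerfectType F).mp hS.perfect
  have histr := (ofFunctor_isOfIsotropicType F).mp hS.isotropic
  have hα : ∀ n, PreFrobenioid.IsDivIdentity F (α n : A ⟶ A) ∧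
      PreFrobenioid.IsFrobeniusType F (α n : A ⟶ A) ∧ PreFrobenioid.degFr F (α n : A ⟶ A) = n :=
    fun n => ⟨(ofFunctor_isDivIdentity F _).mp (hS.alpha n).1,
      (ofFunctor_isFrobeniusType F _).mp (hS.alpha n).2.1, (hS.alpha n).2.2⟩
  have key := PreFrobenioid.isPrimaryPreStep_iff_of_isStep hF hperf histr
    (fun n => (α n : A ⟶ A)) hα hφ
  simp only [ofFunctor_isFrobeniusType]
  exact key

/-- **Proposition 4.1 (ii)** as typed (`Prop41ii`), for a Frobenioid with `Φ` perf-factorial.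
[cite: MochizukiFrdI2008, Prop. 4.1 (ii) p.75] -/
theorem prop41ii_holds (hF : PreFrobenioid.IsFrobenioid F)
    (hpf : Objectwise (fun M _ => IsPerfFactorial M) Φ) (A : C) (α : ℕ+ → End A) :
    (ofFunctor Φ F).Prop41ii A α := by
  intro hS B C' φ ψ hφ hφp hψ
  exact PreFrobenioid.isPrimaryPreStep_comp_iff_of_isStep hF ((ofFunctor_isOfPerfectType F).mp hS.perfect)
    ((ofFunctor_isOfIsotropicType F).mp hS.isotropic) hpf hφ hφp hψ

/-- **Proposition 4.1 (iii)**, criterion, as typed (`Prop41iii_criterion`), with "disjoint supports"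
= disjointness of the supports `Supp` (Def. 2.4 (i)(d)) of the images in `Φ(F)^pf`, for a Frobenioid
with `Φ` perf-factorial. [cite: MochizukiFrdI2008, Prop. 4.1 (iii) p.75] -/
theorem prop41iii_criterion_holds (hF : PreFrobenioid.IsFrobenioid F)
    (hpf : Objectwise (fun M _ => IsPerfFactorial M) Φ) :
    (ofFunctor Φ F).Prop41iii_criterion fun {X} (y y' : Φ.obj (op X)) =>
      Disjoint (supp (factorMap _ (Perfection.of _ y))) (supp (factorMap _ (Perfection.of _ y'))) := by
  intro hperf histr E I F' ε ι hε hι yε yι hyε hyι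
  exact PreFrobenioid.disjoint_supp_iff_isCoprimary hF ((ofFunctor_isOfPerfectType F).mp hperf)
    ((ofFunctor_isOfIsotropicType F).mp histr) hpf hε hι yε yι hyε hyι

/-- **Proposition 4.1 (iii)**, cartesian square, as typed (`Prop41iii_square`), for a Frobenioid with
`Φ` perf-factorial. [cite: MochizukiFrdI2008, Prop. 4.1 (iii) p.75] -/
theorem prop41iii_square_holds (hF : PreFrobenioid.IsFrobenioid F)
    (hpf : Objectwise (fun M _ => IsPerfFactorial M) Φ) : (ofFunctor Φ F).Prop41iii_square := by
  intro hperf histr E I F' ε ι hε hι hcop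
  exact PreFrobenioid.exists_coprimary_square_of_isCoprimary hF ((ofFunctor_isOfPerfectType F).mp hperf)
    ((ofFunctor_isOfIsotropicType F).mp histr) hpf hε hι hcop

/-- **Proposition 4.1 (iv)** as typed (`Prop41iv`), for a Frobenioid with `Φ` perf-factorial.
[cite: MochizukiFrdI2008, Prop. 4.1 (iv) p.76] -/
theorem prop41iv_holds (hF : PreFrobenioid.IsFrobenioid F)
    (hpf : Objectwise (fun M _ => IsPerfFactorial M) Φ) : (ofFunctor Φ F).Prop41iv := by
  intro hperf histr D' E F' δ ε hδ hε
  exact PreFrobenioid.isPrimaryPreStep_iff_exists_prime_over hF ((ofFunctor_isOfPerfectType F).mp hperf)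
    ((ofFunctor_isOfIsotropicType F).mp histr) hpf hδ hε

/-- **Proposition 4.1 (v)** as typed (`Prop41v`), for a Frobenioid with `Φ` perf-factorial.
[cite: MochizukiFrdI2008, Prop. 4.1 (v) p.76] -/
theorem prop41v_holds (hF : PreFrobenioid.IsFrobenioid F)
    (hpf : Objectwise (fun M _ => IsPerfFactorial M) Φ) : (ofFunctor Φ F).Prop41v := by
  intro hperf histr D' E F' δ ε hδ hε
  exact PreFrobenioid.isPrimaryPreStep_iff_exists_prime_under hF ((ofFunctor_isOfPerfectType F).mp hperf)
    ((ofFunctor_isOfIsotropicType F).mp histr) hpf hδ hε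

end PreFrobenioidData

end Literature.AlgebraicGeometry.Frobenioids
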